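import Literature.NumberTheory.Rogawski1990.LocalTransferUnmatchedLocus      -- ★ `compactSpace_cmDatum_local_one_of_smul_eq` (`U(Φ₁)(L⁺_v) = E¹_v` is compact at non-split `v`)
import Summits.HodgeConjecture.HodgeConjecture.Theorems.F0P3cStCharTSCassHTrace   -- ★ (D-b) instance kit on the CM carriers (`t2Space_cmDatum_local`, `secondCountableTopology_local`, `subgroup_gl_one_mul_comm`)
import HarnessLib

/-!
# F0 · P3c · line LH6 «StCharTS» — road (D) «DEEP-FL», (D-c) head glue «HAAR-PROD-SPLIT»: every Haar measure on `H_v = U(Φ₂)_v × U(Φ₁)_v` is a product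
# `ν₂.prod ν₁` of Haar measures on the factors (right-invariant when it is), and the organ's Borel σ-algebra on `H_v` IS the product σ-algebra
# [Rogawski1990, §12.7 L. 12.7.3 (proof) p. 195] [BourbakiINT7, Ch. VII §1 no. 2, §2 no. 7 Prop. 10]

Cell `pub/hodgecm-mathlib`, crux H413 = `stmt-HodgeConjecture-24833` (lane `--supports … --as helper`), route HCCMUnconditional; seat LH6-p02 (g2); road (D) owner
LH6-p04 (g3) (ROAD-D v7 7d68ee66, board v1).  THEOREMS ONLY, sorry-free, ★-only imports; no definition ∕ instance ∕ notation ∕ named fact.  HONEST LABEL: HC_CM is proved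
only modulo the 7 printed citations (2 remaining: hLiu418 = stmt-HodgeConjecture-24832, h413 = stmt-HodgeConjecture-24833) until rung 0 closes; count-neutral head glue.

WHY.  The organ `stub_StXIGSt` (XIG-St v3) quantifies over an ARBITRARY Borel σ-algebra `[MeasurableSpace H_v] [BorelSpace H_v]` and an ARBITRARY Haar measure `νHv` on
`H_v` (`[IsHaarMeasure] [IsMulRightInvariant]`), while the `H`-side trace bricks (★ F1-H p849597, ★ «ST-SHELL-TRACE» p849965, ★ hF1H-ADAPTER p849948, ★ (D-b)) are
stated on the FACTOR σ-algebras at a PRODUCT measure `ν₂.prod ν₁`.  This file closes the gap once: (§1, generic) right invariance of a factor from right invariance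
of the product against a finite non-zero second factor; every Haar measure on `G₁ × G₂` (`G₂` of finite Haar mass) is `ν₁.prod ν₂` with `ν₁` Haar, right-invariant
if the product is (Haar uniqueness ★ `isMulLeftInvariant_eq_smul` + ★ `Measure.prod_smul_left`); the Borel σ-algebra of a second-countable product is the product of
the Borel σ-algebras (★ `Prod.borelSpace`) — so the head may `subst` the organ's instance; (§2, CM) the instantiation on `H_v` (★ `compactSpace_cmDatum_local_one_of_smul_eq`,
`U(Φ₁)_v` abelian ⇒ every left Haar measure on it is right-invariant).

* §1 `isMulRightInvariant_of_prod`, `exists_isHaarMeasure_prod_eq`, `measurableSpace_prod_eq_of_borelSpace`, `isMulRightInvariant_of_forall_comm`.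
* §2 **`exists_haar_prod_eq_cmH`** — `∃ ν₂ ν₁` Haar + right-invariant on `U(Φ₂)_v`, `U(Φ₁)_v` with `ν₂.prod ν₁ = νH`; **`measurableSpace_cmH_eq_prod`**.

## References
* [Rogawski1990] J. D. Rogawski, *Automorphic Representations of Unitary Groups in Three Variables*, Ann. of Math. Stud. 123 (1990), §12.7 Lemma 12.7.3 (proof) p. 195.
* [BourbakiINT7] N. Bourbaki, *Intégration, Chapitres 7 et 8*, Ch. VII §1 no. 2 (uniqueness of Haar measure), §2 no. 7 Prop. 10 (Haar measure of a product).
* [GetzHahn2024] J. Getz, H. Hahn, *An Introduction to Automorphic Representations*, GTM 300 (2024), §3.2.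
-/

set_option autoImplicit false
-- the mandated namespace has the single-problem summit's repeated segment (`HodgeConjecture.HodgeConjecture`)
set_option linter.dupNamespace false

noncomputable section

open NumberField IsDedekindDomain MeasureTheory Topology Measure
open scoped Matrix MatrixGroups Pointwise NNReal ENNReal
open Literature.NumberTheory Literature.NumberTheory.Automorphic Literature.NumberTheory.Automorphic.UnitaryGroup
open Literature.NumberTheory.GaloisRepresentations
open Literature.NumberTheory.Rogawski1990

namespace Summit.HodgeConjecture.HodgeConjecture.Cruxes.H413.F0P3cStCharTSHaarProdSplit

/-! ## §1 Generic: Haar measures on a product with a factor of finite mass -/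

section Generic

variable {G₁ G₂ : Type*} [Group G₁] [TopologicalSpace G₁] [MeasurableSpace G₁]
  [Group G₂] [TopologicalSpace G₂] [MeasurableSpace G₂]

omit [TopologicalSpace G₁] [TopologicalSpace G₂] in
/-- **Right invariance of the first factor**: if `ν₁.prod ν₂` is right-invariant and `0 < ν₂(G₂) < ∞`, then `ν₁` is right-invariant (test on `A ×ˢ univ`).
[cite: BourbakiINT7, Ch. VII §2 no. 7 Prop. 10] -/
theorem isMulRightInvariant_of_prod [MeasurableMul G₁] [MeasurableMul G₂] (ν₁ : Measure G₁) (ν₂ : Measure G₂) [SFinite ν₁] [SFinite ν₂]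
    (h0 : ν₂ Set.univ ≠ 0) (htop : ν₂ Set.univ ≠ ∞) [(ν₁.prod ν₂).IsMulRightInvariant] : ν₁.IsMulRightInvariant := by
  refine ⟨fun g => Measure.ext fun A _ => ?_⟩
  have h := map_mul_right_eq_self (ν₁.prod ν₂) (g, (1 : G₂))
  change Measure.map (Prod.map (· * g) (· * (1 : G₂))) (ν₁.prod ν₂) = ν₁.prod ν₂ at h
  rw [← Measure.map_prod_map _ _ (measurable_mul_const g) (measurable_mul_const (1 : G₂))] at h
  have h1 : Measure.map (· * (1 : G₂)) ν₂ = ν₂ := by simp only [mul_one]; exact Measure.map_id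
  rw [h1] at h
  have hA := congrArg (fun m : Measure (G₁ × G₂) => m (A ×ˢ (Set.univ : Set G₂))) h
  simp only [Measure.prod_prod] at hA
  exact (ENNReal.mul_left_inj h0 htop).1 hA

omit [TopologicalSpace G₁] in
/-- **Right invariance on an abelian-by-hypothesis group**: if all elements commute, a left-invariant measure is right-invariant. [cite: BourbakiINT7, Ch. VII §1 no. 2] -/
theorem isMulRightInvariant_of_forall_comm [MeasurableMul G₁] (μ : Measure G₁) [μ.IsMulLeftInvariant] (hcomm : ∀ a b : G₁, a * b = b * a) :
    μ.IsMulRightInvariant := by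
  refine ⟨fun g => ?_⟩
  have hfun : (fun x : G₁ => x * g) = fun x => g * x := funext fun x => hcomm x g
  rw [hfun]
  exact map_mul_left_eq_self μ g

variable [IsTopologicalGroup G₁] [BorelSpace G₁] [LocallyCompactSpace G₁] [SecondCountableTopology G₁]
  [IsTopologicalGroup G₂] [BorelSpace G₂] [LocallyCompactSpace G₂] [SecondCountableTopology G₂]

/-- **Every Haar measure on `G₁ × G₂` splits off a Haar measure of finite mass on `G₂`**: for `μ` Haar on `G₁ × G₂` and `ν₂` Haar with `ν₂(G₂) < ∞`, there is a Haar
measure `ν₁` on `G₁` with `ν₁.prod ν₂ = μ`; `ν₁` is right-invariant when `μ` is.  (Haar uniqueness: `μ = c • (haar.prod ν₂)`, `ν₁ := c • haar`.)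
[cite: BourbakiINT7, Ch. VII §1 no. 2; §2 no. 7 Prop. 10] -/
theorem exists_isHaarMeasure_prod_eq (μ : Measure (G₁ × G₂)) [μ.IsHaarMeasure] [μ.IsMulRightInvariant]
    (ν₂ : Measure G₂) [ν₂.IsHaarMeasure] [IsFiniteMeasure ν₂] :
    ∃ ν₁ : Measure G₁, ν₁.IsHaarMeasure ∧ ν₁.IsMulRightInvariant ∧ ν₁.prod ν₂ = μ := by
  haveI : SigmaCompactSpace G₁ := sigmaCompactSpace_of_locallyCompact_secondCountable
  haveI : SigmaCompactSpace G₂ := sigmaCompactSpace_of_locallyCompact_secondCountable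
  set c : ℝ≥0 := haarScalarFactor μ ((haar : Measure G₁).prod ν₂) with hc_def
  have hμ : μ = c • ((haar : Measure G₁).prod ν₂) := isMulLeftInvariant_eq_smul μ _
  have hc : c ≠ 0 := (haarScalarFactor_pos_of_isHaarMeasure μ _).ne'
  have hH : (c • (haar : Measure G₁)).IsHaarMeasure := by
    rw [ENNReal.smul_def]
    exact IsHaarMeasure.smul _ (by exact_mod_cast hc) ENNReal.coe_ne_top
  haveI := hH
  have hprod : (c • (haar : Measure G₁)).prod ν₂ = μ := by rw [Measure.prod_smul_left, ← hμ]
  haveI : ((c • (haar : Measure G₁)).prod ν₂).IsMulRightInvariant := by rw [hprod]; infer_instance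
  exact ⟨c • (haar : Measure G₁), hH,
    isMulRightInvariant_of_prod (c • (haar : Measure G₁)) ν₂ (isOpen_univ.measure_ne_zero ν₂ Set.univ_nonempty) (measure_ne_top ν₂ _), hprod⟩

omit [MeasurableSpace G₁] [MeasurableSpace G₂] [Group G₁] [Group G₂] [IsTopologicalGroup G₁] [BorelSpace G₁] [LocallyCompactSpace G₁]
  [IsTopologicalGroup G₂] [BorelSpace G₂] [LocallyCompactSpace G₂] [SecondCountableTopology G₂] in
/-- **The Borel σ-algebra of a product is the product of the Borel σ-algebras** (one factor second countable): an arbitrary `[MeasurableSpace (G₁ × G₂)]` with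
`[BorelSpace (G₁ × G₂)]` EQUALS `Prod.instMeasurableSpace` over `borel G₁`, `borel G₂` — the head `subst`s it. [cite: BourbakiINT7, Ch. VII §2 no. 7 Prop. 10] -/
theorem measurableSpace_prod_eq_of_borelSpace (m : MeasurableSpace (G₁ × G₂)) [@BorelSpace (G₁ × G₂) _ m] :
    m = @Prod.instMeasurableSpace G₁ G₂ (borel G₁) (borel G₂) := by
  letI : MeasurableSpace G₁ := borel G₁
  letI : MeasurableSpace G₂ := borel G₂
  haveI : BorelSpace G₁ := ⟨rfl⟩
  haveI : BorelSpace G₂ := ⟨rfl⟩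
  rw [@BorelSpace.measurable_eq (G₁ × G₂) _ m _]
  exact (Prod.borelSpace (α := G₁) (β := G₂)).measurable_eq.symm

end Generic

/-! ## §2 `H_v = U(Φ₂)(L⁺_v) × U(Φ₁)(L⁺_v)` -/

section CM

variable (L : Type) [Field L] [NumberField L] [IsCMField L] (v : HeightOneSpectrum (𝓞 ↥(maximalRealSubfield L)))

/-- **«HAAR-PROD-SPLIT» on `H_v`**: at a non-split `v` (witnessed by `w ∣ v`, `c·w = w`), every Haar measure `νH` on `H_v = U(Φ₂)_v × U(Φ₁)_v` which is right-invariant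
is `ν₂.prod ν₁` with `ν₂`, `ν₁` Haar AND right-invariant on the factors (`U(Φ₁)_v = E¹_v` compact abelian; §1).  The factor σ-algebras are the given Borel ones.
[cite: Rogawski1990, §12.7 Lemma 12.7.3 (proof) p. 195] [cite: BourbakiINT7, Ch. VII §2 no. 7 Prop. 10] -/
theorem exists_haar_prod_eq_cmH (w : PlacesOver L v) (hw : IsCMField.complexConj L • w.1 = w.1)
    [MeasurableSpace ((cmDatum L 2 (Matrix.of fun i j : Fin 2 => if i.val + j.val + 1 = 2 then (1 : L) else 0)).Local v)]
    [BorelSpace ((cmDatum L 2 (Matrix.of fun i j : Fin 2 => if i.val + j.val + 1 = 2 then (1 : L) else 0)).Local v)]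
    [MeasurableSpace ((cmDatum L 1 (Matrix.of fun i j : Fin 1 => if i.val + j.val + 1 = 1 then (1 : L) else 0)).Local v)]
    [BorelSpace ((cmDatum L 1 (Matrix.of fun i j : Fin 1 => if i.val + j.val + 1 = 1 then (1 : L) else 0)).Local v)]
    (νH : Measure (((cmDatum L 2 (Matrix.of fun i j : Fin 2 => if i.val + j.val + 1 = 2 then (1 : L) else 0)).Local v) ×
      ((cmDatum L 1 (Matrix.of fun i j : Fin 1 => if i.val + j.val + 1 = 1 then (1 : L) else 0)).Local v)))
    [νH.IsHaarMeasure] [νH.IsMulRightInvariant] :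
    ∃ (ν₂ : Measure ((cmDatum L 2 (Matrix.of fun i j : Fin 2 => if i.val + j.val + 1 = 2 then (1 : L) else 0)).Local v))
      (ν₁ : Measure ((cmDatum L 1 (Matrix.of fun i j : Fin 1 => if i.val + j.val + 1 = 1 then (1 : L) else 0)).Local v)),
      ν₂.IsHaarMeasure ∧ ν₂.IsMulRightInvariant ∧ ν₁.IsHaarMeasure ∧ ν₁.IsMulRightInvariant ∧ ν₂.prod ν₁ = νH := by
  haveI : IsTopologicalGroup ((cmDatum L 2 (Matrix.of fun i j : Fin 2 => if i.val + j.val + 1 = 2 then (1 : L) else 0)).Local v) :=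
    inferInstanceAs (IsTopologicalGroup ↥(unitaryGroupOfForm (conjLocal L (IsCMField.complexConj L) v) (cmLocalForm L 2 v)))
  haveI : LocallyCompactSpace ((cmDatum L 2 (Matrix.of fun i j : Fin 2 => if i.val + j.val + 1 = 2 then (1 : L) else 0)).Local v) :=
    locallyCompactSpace_local (IsCMField.complexConj L) 2 _ v
  haveI : SecondCountableTopology ((cmDatum L 2 (Matrix.of fun i j : Fin 2 => if i.val + j.val + 1 = 2 then (1 : L) else 0)).Local v) :=
    secondCountableTopology_local (IsCMField.complexConj L) 2 _ v
  haveI : LocallyCompactSpace ((cmDatum L 1 (Matrix.of fun i j : Fin 1 => if i.val + j.val + 1 = 1 then (1 : L) else 0)).Local v) :=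
    locallyCompactSpace_local (IsCMField.complexConj L) 1 _ v
  haveI : SecondCountableTopology ((cmDatum L 1 (Matrix.of fun i j : Fin 1 => if i.val + j.val + 1 = 1 then (1 : L) else 0)).Local v) :=
    secondCountableTopology_local (IsCMField.complexConj L) 1 _ v
  haveI := nonarchimedeanGroup_cmLocal L 2 v
  haveI : NonarchimedeanGroup ((cmDatum L 1 (Matrix.of fun i j : Fin 1 => if i.val + j.val + 1 = 1 then (1 : L) else 0)).Local v) := nonarchimedeanGroup_cmLocal L 1 v
  haveI : CompactSpace ((cmDatum L 1 (Matrix.of fun i j : Fin 1 => if i.val + j.val + 1 = 1 then (1 : L) else 0)).Local v) :=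
    compactSpace_cmDatum_local_one_of_smul_eq L v w hw
  -- `ν₁ :=` the Haar probability-class measure on the compact abelian `U(Φ₁)_v`
  set ν₁ : Measure ((cmDatum L 1 (Matrix.of fun i j : Fin 1 => if i.val + j.val + 1 = 1 then (1 : L) else 0)).Local v) := haar with hν₁
  haveI : IsFiniteMeasure ν₁ := by
    refine ⟨?_⟩
    exact IsCompact.measure_lt_top isCompact_univ
  have hν₁r : ν₁.IsMulRightInvariant :=
    isMulRightInvariant_of_forall_comm ν₁ fun a b => F0P3cStCharTSCassHTrace.subgroup_gl_one_mul_comm _ a b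
  obtain ⟨ν₂, hν₂, hν₂r, hprod⟩ := exists_isHaarMeasure_prod_eq νH ν₁
  exact ⟨ν₂, ν₁, hν₂, hν₂r, inferInstance, hν₁r, hprod⟩

/-- **The organ's σ-algebra on `H_v` is the product one**: `‹MeasurableSpace H_v› = Prod.instMeasurableSpace` over `borel U(Φ₂)_v`, `borel U(Φ₁)_v` (§1; the head
`subst`s this and then works on the factor σ-algebras). [cite: BourbakiINT7, Ch. VII §2 no. 7 Prop. 10] -/
theorem measurableSpace_cmH_eq_prod
    (m : MeasurableSpace (((cmDatum L 2 (Matrix.of fun i j : Fin 2 => if i.val + j.val + 1 = 2 then (1 : L) else 0)).Local v) ×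
      ((cmDatum L 1 (Matrix.of fun i j : Fin 1 => if i.val + j.val + 1 = 1 then (1 : L) else 0)).Local v)))
    [@BorelSpace (((cmDatum L 2 (Matrix.of fun i j : Fin 2 => if i.val + j.val + 1 = 2 then (1 : L) else 0)).Local v) ×
      ((cmDatum L 1 (Matrix.of fun i j : Fin 1 => if i.val + j.val + 1 = 1 then (1 : L) else 0)).Local v)) _ m] :
    m = @Prod.instMeasurableSpace _ _ (borel ((cmDatum L 2 (Matrix.of fun i j : Fin 2 => if i.val + j.val + 1 = 2 then (1 : L) else 0)).Local v))
      (borel ((cmDatum L 1 (Matrix.of fun i j : Fin 1 => if i.val + j.val + 1 = 1 then (1 : L) else 0)).Local v)) := by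
  haveI : SecondCountableTopology ((cmDatum L 2 (Matrix.of fun i j : Fin 2 => if i.val + j.val + 1 = 2 then (1 : L) else 0)).Local v) :=
    secondCountableTopology_local (IsCMField.complexConj L) 2 _ v
  exact measurableSpace_prod_eq_of_borelSpace m

end CM

end Summit.HodgeConjecture.HodgeConjecture.Cruxes.H413.F0P3cStCharTSHaarProdSplit

end
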